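import Mathlib
import HarnessLib
import Summits.HubbardSuperconductivity.HubbardSuperconductivity.Theorems.KLProgrammeKLRegimeEngineDressedAliasingDiff
import Summits.HubbardSuperconductivity.HubbardSuperconductivity.Theorems.KLProgrammeKLRegimeEngineDressedAliasingLast
import Summits.HubbardSuperconductivity.HubbardSuperconductivity.Theorems.KLProgrammePerturbedFermiCurveCompChainStruct
import Literature.Analysis.Calculus.IteratedDerivLeibnizBound

/-!
# K3 gen-8-FLOW (stmt 20437, stub (C), located item #20, cure (δ′) «LAST-STEP SWAP», response door layer B2): DRESSED REAL DATA READ ALONG A CURVE —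
# `θ`-jets of `θ ↦ evalM (symInterp L Re(g∘p·h)) (γ θ)` from the TANGENTIAL jets of `Re g ∘ γ`, the moments of `h`, the curve's jets and the alias sups

Cell gate-hubbard-kl, seat p2 g17.  Layer A (`…EngineDressedAliasingDiff`, p606223) controls `Δ := evalM (symInterp L Re(g∘p·H)) − (Re g·P₁ − Im g·P₂)` in every
Fréchet jet at every point.  Here the data are REAL (`H = h : TorusSite → ℝ`, as the last-step response's three data `1`, `klLocSelfEnergyRe … K_N N`,
`(π/β)(1 − klFieldStrength … K_N N)` are), so the odd near polynomial `P₂` VANISHES IDENTICALLY (§1: `𝔉⁻¹h(−x) = conj 𝔉⁻¹h(x)`, `h_{−x} = h_x`, the near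
set is symmetric), the exact main term is `Re g · P₁`, and along a `C⁴` curve `γ` (the old Fermi-point map)

  `R(θ) := evalM (symInterp L Re(g∘p·h)) (γ θ) = Φ(θ)·P₁(γ θ) + Δ(γ θ)`,   `Φ := Re g ∘ γ`,

so the `θ`-jets of `R` need ONLY the jets of the scalar profile `Φ` (layer B1: first/second/third order in the dressing parameter — the normal-direction
growth `ω₀⁻¹` of `g` never enters), the moments of `h` (for `P₁ ∘ γ`, Bell's formula with the curve's jets) and the GLOBAL alias sups of layer A
(for `Δ ∘ γ`).  Output in abstract-table form (Leibniz rows `Σ C(k,i)·φᵢ·PP_{k−i}` + Bell rows `AA_k`), the fit being the closer's arithmetic.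

* §1 `torusFourierInv_ofReal_neg`, `sum_near_im_torusFourierInv_mul_harmonic_eq_zero` (`P₂ ≡ 0` for real data);
* §2 `norm_iteratedFDeriv_nearPoly_le` (`‖DᵐP₁(q)‖ ≤ M_m(h)`, every `m`, every `q`);
* §3 **`abs_iteratedDeriv_dressed_comp_le`** — THE LAYER: `C⁴` + `|∂ᵏR(θ)| ≤ Σ_{i≤k} C(k,i)·φ i·PP (k−i) + AA k` (`k ≤ 4`).

Pure harmonic analysis / calculus; no definitions; nothing about the Hubbard model is asserted; nothing asserts superconductivity.
References: BGM 2006 §2.3 (2.17), §2.4 (2.36)–(2.40) [cite: BenfattoGiulianiMastropietro2006]; Boyd 2001 §4.5 [cite: Boyd2001].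
-/

noncomputable section

namespace Summit.HubbardSuperconductivity.HubbardSuperconductivity.Theorems.EngineV8

set_option linter.dupNamespace false -- summit = problem name (single-conjunct summit), D-0017

open Real Set MeasureTheory UnitAddTorus Finset Filter Literature.MathematicalPhysics.QuantumLattice Literature.Probability.LatticeModels
open Literature.Analysis.Fourier Literature.Analysis.FunctionSpaces Literature.Analysis.Calculus
open Summit.HubbardSuperconductivity.HubbardSuperconductivity.Theorems.KLRegimeSplit
open Summit.HubbardSuperconductivity.HubbardSuperconductivity.Theorems.C4a
open Summit.HubbardSuperconductivity.HubbardSuperconductivity.Theorems.PerturbedFermiCurve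
open scoped ComplexConjugate

variable {L : ℕ} [NeZero L]

/-! ## §1 Real data: the odd near polynomial vanishes -/

/-- For REAL lattice data the inverse torus Fourier coefficients are conjugation-odd under `x ↦ −x`: `𝔉⁻¹h(−x) = conj 𝔉⁻¹h(x)`. -/
theorem torusFourierInv_ofReal_neg (h : TorusSite 2 L → ℝ) (x : TorusSite 2 L) :
    torusFourierInv (fun k => ((h k : ℝ) : ℂ)) (-x) = conj (torusFourierInv (fun k => ((h k : ℝ) : ℂ)) x) := by
  unfold torusFourierInv
  rw [map_mul, map_sum]
  congr 1
  · rw [map_inv₀, map_pow, Complex.conj_natCast]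
  · refine sum_congr rfl fun k _ => ?_
    rw [map_mul, Complex.conj_ofReal]
    congr 1
    have hk : (∏ i, (ZMod.stdAddChar (k i * (-x) i) : ℂ)) = torusChar k (-x) := rfl
    have hk' : (∏ i, (ZMod.stdAddChar (k i * x i) : ℂ)) = torusChar k x := rfl
    rw [hk, hk', torusChar_neg_right]

/-- **`P₂ ≡ 0` for real data**: `Σ_{x near} Im 𝔉⁻¹h(x)·h_{|x̃₀|,|x̃₁|}(q) = 0` (the summand is odd under the involution `x ↦ −x` of the near set). -/
theorem sum_near_im_torusFourierInv_mul_harmonic_eq_zero (h : TorusSite 2 L → ℝ) (q : Fin 2 → ℝ) :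
    ∑ x ∈ univ.filter (fun x : TorusSite 2 L => ∀ i, 4 * |(x i).valMinAbs| ≤ (L : ℤ)),
        (torusFourierInv (fun k => ((h k : ℝ) : ℂ)) x).im * TrigPolyC4v.harmonic (x 0).valMinAbs.natAbs (x 1).valMinAbs.natAbs q = 0 := by
  set near := univ.filter (fun x : TorusSite 2 L => ∀ i, 4 * |(x i).valMinAbs| ≤ (L : ℤ)) with hnear
  set f : TorusSite 2 L → ℝ := fun x => (torusFourierInv (fun k => ((h k : ℝ) : ℂ)) x).im *
    TrigPolyC4v.harmonic (x 0).valMinAbs.natAbs (x 1).valMinAbs.natAbs q with hf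
  have habs : ∀ (x : TorusSite 2 L) (i : Fin 2), |((-x) i).valMinAbs| = |(x i).valMinAbs| := by
    intro x i
    rw [Pi.neg_apply, Int.abs_eq_natAbs, Int.abs_eq_natAbs, ZMod.natAbs_valMinAbs_neg]
  have hmem : ∀ x : TorusSite 2 L, x ∈ near ↔ -x ∈ near := by
    intro x
    rw [hnear, Finset.mem_filter, Finset.mem_filter]
    simp only [Finset.mem_univ, true_and]
    exact forall_congr' fun i => by rw [habs x i]
  have hodd : ∀ x : TorusSite 2 L, f (-x) = -f x := by
    intro x
    simp only [hf, torusFourierInv_ofReal_neg, Complex.conj_im, Pi.neg_apply, ZMod.natAbs_valMinAbs_neg, neg_mul]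
  have hre : ∑ x ∈ near, f x = ∑ x ∈ near, f (-x) :=
    Finset.sum_equiv (Equiv.neg (TorusSite 2 L)) (fun x => by simpa using hmem x) (fun x _ => by simp)
  have h2 : ∑ x ∈ near, f x = -∑ x ∈ near, f x :=
    calc ∑ x ∈ near, f x = ∑ x ∈ near, f (-x) := hre
      _ = ∑ x ∈ near, -f x := sum_congr rfl fun x _ => hodd x
      _ = -∑ x ∈ near, f x := by rw [Finset.sum_neg_distrib]
  show ∑ x ∈ near, f x = 0
  linarith

/-! ## §2 The even near polynomial `P₁` and its jets by the moments -/

/-- **`‖Dᵐ P₁(q)‖ ≤ Σ_x (1+|x̃₀|+|x̃₁|)ᵐ‖𝔉⁻¹H(x)‖`** for the near polynomial `P₁ = Σ_{x near} Re 𝔉⁻¹H(x)·h_x`, every order `m`, every point `q`. -/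
theorem norm_iteratedFDeriv_nearPoly_le (H : TorusSite 2 L → ℂ) (m : ℕ) (q : Momentum) {Mm : ℝ}
    (hMm : ∑ x : TorusSite 2 L, (1 + ((x 0).valMinAbs.natAbs : ℝ) + ((x 1).valMinAbs.natAbs : ℝ)) ^ m * ‖torusFourierInv H x‖ ≤ Mm) :
    ‖iteratedFDeriv ℝ m (fun q : Momentum => ∑ x ∈ univ.filter (fun x : TorusSite 2 L => ∀ i, 4 * |(x i).valMinAbs| ≤ (L : ℤ)),
        (torusFourierInv H x).re * TrigPolyC4v.harmonic (x 0).valMinAbs.natAbs (x 1).valMinAbs.natAbs (WithLp.ofLp q)) q‖ ≤ Mm := by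
  classical
  obtain ⟨B₁, c₁, -, hP₁', hM₁⟩ := exists_trigPoly_of_near_harmonics (L := L) (fun x => (torusFourierInv H x).re)
  have hfun : (fun q : Momentum => ∑ x ∈ univ.filter (fun x : TorusSite 2 L => ∀ i, 4 * |(x i).valMinAbs| ≤ (L : ℤ)),
        (torusFourierInv H x).re * TrigPolyC4v.harmonic (x 0).valMinAbs.natAbs (x 1).valMinAbs.natAbs (WithLp.ofLp q)) =
      fun q : Momentum => ∑ y ∈ B₁, c₁ y * Real.cos (∑ i : Fin 2, (y i : ℝ) * q i) := funext fun q => hP₁' (WithLp.ofLp q)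
  rw [hfun]
  refine (norm_iteratedFDeriv_cosPoly_le B₁ c₁ m q).trans ((hM₁ m).trans (le_trans ?_ hMm))
  have hwt : ∀ x : TorusSite 2 L, 0 ≤ (1 + ((x 0).valMinAbs.natAbs : ℝ) + ((x 1).valMinAbs.natAbs : ℝ)) ^ m := fun x => by positivity
  refine (sum_le_sum_of_subset_of_nonneg (filter_subset _ _) fun x _ _ => by positivity).trans (sum_le_sum fun x _ => ?_)
  rw [mul_comm]
  exact mul_le_mul_of_nonneg_left (Complex.abs_re_le_norm _) (hwt x)

/-- The near polynomial is `C^∞`. -/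
theorem contDiff_nearPoly (H : TorusSite 2 L → ℂ) {n : WithTop ℕ∞} :
    ContDiff ℝ n (fun q : Momentum => ∑ x ∈ univ.filter (fun x : TorusSite 2 L => ∀ i, 4 * |(x i).valMinAbs| ≤ (L : ℤ)),
        (torusFourierInv H x).re * TrigPolyC4v.harmonic (x 0).valMinAbs.natAbs (x 1).valMinAbs.natAbs (WithLp.ofLp q)) := by
  classical
  obtain ⟨B₁, c₁, -, hP₁', -⟩ := exists_trigPoly_of_near_harmonics (L := L) (fun x => (torusFourierInv H x).re)
  have hfun : (fun q : Momentum => ∑ x ∈ univ.filter (fun x : TorusSite 2 L => ∀ i, 4 * |(x i).valMinAbs| ≤ (L : ℤ)),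
        (torusFourierInv H x).re * TrigPolyC4v.harmonic (x 0).valMinAbs.natAbs (x 1).valMinAbs.natAbs (WithLp.ofLp q)) =
      fun q : Momentum => ∑ y ∈ B₁, c₁ y * Real.cos (∑ i : Fin 2, (y i : ℝ) * q i) := funext fun q => hP₁' (WithLp.ofLp q)
  rw [hfun]
  exact ContDiff.sum fun y _ => contDiff_const.mul (contDiff_cos_planeWave y)

/-! ## §3 THE LAYER: dressed real data read along a curve -/

/-- **DRESSED REAL DATA ALONG A CURVE.**  `g : Momentum → ℂ` smooth, `2π`-periodic, reflection/swap-symmetric, `‖D^M g‖ ≤ D_g` (`8 ≤ M`), `‖g‖ ≤ A₀`;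
REAL data `h` with moments `Σ_x(1+|x̃₀|+|x̃₁|)ᵐ‖𝔉⁻¹h(x)‖ ≤ Mm m` (`m ≤ 4`) and `≤ Ms` at order `s`; a `C⁴` curve `γ` with `‖γ⁽ⁱ⁾(θ)‖ ≤ Dc i` (`1 ≤ i ≤ 4`);
the profile `Φ = Re g ∘ γ`, `C⁴` with `|Φ⁽ⁱ⁾(θ)| ≤ φ i` (`i ≤ 4`); tables: `AL` above layer A's alias+far bound at orders `≤ 4`, `PP` above the Bell rows of
`(Dc, Mm)` (`PP 0 ≥ Mm 0`), `AA` above the Bell rows of `(Dc, AL)` (`AA 0 ≥ AL 0`).  Then `R(θ) = evalM (symInterp L Re(g∘p·h)) (γ θ)` is `C⁴` and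
`|∂ᵏR(θ)| ≤ Σ_{i ≤ k} C(k,i)·φ i·PP (k−i) + AA k` for `k ≤ 4`. -/
theorem abs_iteratedDeriv_dressed_comp_le {g : Momentum → ℂ}
    (hgper : ∀ (i : Fin 2) (q : Momentum), g (q + EuclideanSpace.single i (2 * π)) = g q) (hg : ContDiff ℝ (⊤ : ℕ∞) g)
    (hrefl : ∀ p : Fin 2 → ℝ, g (WithLp.toLp 2 ![p 0, -p 1]) = g (WithLp.toLp 2 p))
    (hswap : ∀ p : Fin 2 → ℝ, g (WithLp.toLp 2 ![p 1, p 0]) = g (WithLp.toLp 2 p))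
    {M : ℕ} (hM : 8 ≤ M) {Dg : ℝ} (hDg : ∀ q, ‖iteratedFDeriv ℝ M g q‖ ≤ Dg) {A₀ : ℝ} (hA₀ : ∀ q, ‖g q‖ ≤ A₀)
    (h : TorusSite 2 L → ℝ) {Mm : ℕ → ℝ}
    (hMm : ∀ m ≤ 4, ∑ x : TorusSite 2 L, (1 + ((x 0).valMinAbs.natAbs : ℝ) + ((x 1).valMinAbs.natAbs : ℝ)) ^ m *
      ‖torusFourierInv (fun k => ((h k : ℝ) : ℂ)) x‖ ≤ Mm m)
    {s : ℕ} {Ms : ℝ} (hMs : ∑ x : TorusSite 2 L, (1 + ((x 0).valMinAbs.natAbs : ℝ) + ((x 1).valMinAbs.natAbs : ℝ)) ^ s *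
      ‖torusFourierInv (fun k => ((h k : ℝ) : ℂ)) x‖ ≤ Ms)
    {γ : ℝ → Momentum} (hγ : ContDiff ℝ 4 γ) {θ : ℝ} {Dc : ℕ → ℝ} (hDc : ∀ i, 1 ≤ i → i ≤ 4 → ‖iteratedDeriv i γ θ‖ ≤ Dc i)
    {Φ : ℝ → ℝ} (hΦ : ∀ θ' : ℝ, (g (γ θ')).re = Φ θ') (hΦd : ContDiff ℝ 4 Φ) {φ : ℕ → ℝ} (hφ : ∀ i ≤ 4, |iteratedDeriv i Φ θ| ≤ φ i)
    {AL : ℕ → ℝ}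
    (hAL : ∀ j ≤ 4, 2 * (2 * (Mm j * ((3 : ℝ) ^ j * Dg * (2 / ((2 * (L / 4 + 1) : ℕ) : ℝ)) ^ (M - j - 4) *
        (2 ^ 2 * ∑' k : Fin 2 → ℤ, ∏ i, (1 + (k i : ℝ) ^ 2)⁻¹)))) + (L : ℝ) ^ 2 * (L : ℝ) ^ j * (A₀ * (Ms / (1 + (L : ℝ) / 4) ^ s)) ≤ AL j)
    {PP : ℕ → ℝ} (hPP0 : Mm 0 ≤ PP 0) (hPP1 : Mm 1 * Dc 1 ≤ PP 1) (hPP2 : Mm 2 * Dc 1 ^ 2 + Mm 1 * Dc 2 ≤ PP 2)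
    (hPP3 : Mm 3 * Dc 1 ^ 3 + 3 * Mm 2 * Dc 1 * Dc 2 + Mm 1 * Dc 3 ≤ PP 3)
    (hPP4 : Mm 4 * Dc 1 ^ 4 + 6 * Mm 3 * Dc 1 ^ 2 * Dc 2 + 3 * Mm 2 * Dc 2 ^ 2 + 4 * Mm 2 * Dc 1 * Dc 3 + Mm 1 * Dc 4 ≤ PP 4)
    {AA : ℕ → ℝ} (hAA0 : AL 0 ≤ AA 0) (hAA1 : AL 1 * Dc 1 ≤ AA 1) (hAA2 : AL 2 * Dc 1 ^ 2 + AL 1 * Dc 2 ≤ AA 2)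
    (hAA3 : AL 3 * Dc 1 ^ 3 + 3 * AL 2 * Dc 1 * Dc 2 + AL 1 * Dc 3 ≤ AA 3)
    (hAA4 : AL 4 * Dc 1 ^ 4 + 6 * AL 3 * Dc 1 ^ 2 * Dc 2 + 3 * AL 2 * Dc 2 ^ 2 + 4 * AL 2 * Dc 1 * Dc 3 + AL 1 * Dc 4 ≤ AA 4) :
    ContDiff ℝ 4 (fun θ : ℝ => evalM (symInterp L (fun k : TorusSite 2 L => (g (WithLp.toLp 2 (latticeMomentum L k)) * ((h k : ℝ) : ℂ)).re)) (γ θ)) ∧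
    ∀ k ≤ 4, |iteratedDeriv k (fun θ : ℝ => evalM (symInterp L (fun k : TorusSite 2 L => (g (WithLp.toLp 2 (latticeMomentum L k)) * ((h k : ℝ) : ℂ)).re)) (γ θ)) θ|
      ≤ (∑ i ∈ range (k + 1), (k.choose i : ℝ) * φ i * PP (k - i)) + AA k := by
  classical
  -- the objects
  set H : TorusSite 2 L → ℂ := fun k => ((h k : ℝ) : ℂ) with hH
  set I : Momentum → ℝ := evalM (symInterp L (fun k : TorusSite 2 L => (g (WithLp.toLp 2 (latticeMomentum L k)) * H k).re)) with hI
  set P₁ : Momentum → ℝ := fun q => ∑ x ∈ univ.filter (fun x : TorusSite 2 L => ∀ i, 4 * |(x i).valMinAbs| ≤ (L : ℤ)),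
      (torusFourierInv H x).re * TrigPolyC4v.harmonic (x 0).valMinAbs.natAbs (x 1).valMinAbs.natAbs (WithLp.ofLp q) with hP₁
  set P₂ : Momentum → ℝ := fun q => ∑ x ∈ univ.filter (fun x : TorusSite 2 L => ∀ i, 4 * |(x i).valMinAbs| ≤ (L : ℤ)),
      (torusFourierInv H x).im * TrigPolyC4v.harmonic (x 0).valMinAbs.natAbs (x 1).valMinAbs.natAbs (WithLp.ofLp q) with hP₂
  set E : Momentum → ℝ := fun q => (g q).re * P₁ q - (g q).im * P₂ q with hE
  set Δ : Momentum → ℝ := fun q => I q - E q with hΔ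
  -- `P₂ ≡ 0`, so `E = Re g · P₁`
  have hP₂0 : ∀ q, P₂ q = 0 := fun q => sum_near_im_torusFourierInv_mul_harmonic_eq_zero h (WithLp.ofLp q)
  have hE' : E = fun q => (g q).re * P₁ q := by funext q; simp only [hE, hP₂0, mul_zero, sub_zero]
  -- smoothness
  have hIs : ContDiff ℝ (⊤ : ℕ∞) I := contDiff_evalM _
  have hP₁s : ContDiff ℝ (⊤ : ℕ∞) P₁ := contDiff_nearPoly H
  have hgre : ContDiff ℝ (⊤ : ℕ∞) (fun q => (g q).re) := Complex.reCLM.contDiff.comp hg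
  have hEs : ContDiff ℝ (⊤ : ℕ∞) E := by rw [hE']; exact hgre.mul hP₁s
  have hΔs : ContDiff ℝ (⊤ : ℕ∞) Δ := hIs.sub hEs
  have h4top : (((4 : ℕ) : ℕ∞) : WithTop ℕ∞) ≤ ((⊤ : ℕ∞) : WithTop ℕ∞) := by exact_mod_cast le_top
  have hΔ4 : ContDiff ℝ 4 Δ := by exact_mod_cast hΔs.of_le h4top
  have hP₁4 : ContDiff ℝ 4 P₁ := by exact_mod_cast hP₁s.of_le h4top
  -- layer A: global Fréchet jets of `Δ`
  have hΔjet : ∀ j ≤ 4, ∀ q : Momentum, ‖iteratedFDeriv ℝ j Δ q‖ ≤ AL j := by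
    intro j hj q
    have hMj : 4 + j ≤ M := by omega
    have hA := norm_iteratedFDeriv_evalM_symInterp_dressed_sub_le hgper hg hrefl hswap H hMj hDg hA₀ (hMm j hj) hMs q
    have hjN : ((j : ℕ∞) : WithTop ℕ∞) ≤ ((⊤ : ℕ∞) : WithTop ℕ∞) := by exact_mod_cast le_top
    have hsub : iteratedFDeriv ℝ j Δ q = iteratedFDeriv ℝ j I q - iteratedFDeriv ℝ j E q := by
      rw [hΔ]; exact iteratedFDeriv_sub_apply (hIs.contDiffAt.of_le hjN) (hEs.contDiffAt.of_le hjN)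
    rw [hsub]
    exact hA.trans (hAL j hj)
  -- the decomposition along the curve
  have hR : (fun θ : ℝ => I (γ θ)) = (fun θ => Φ θ * P₁ (γ θ)) + (Δ ∘ γ) := by
    funext θ
    simp only [Pi.add_apply, Function.comp_apply, hΔ, hE', ← hΦ θ]
    ring
  have hPγ : ContDiff ℝ 4 (fun θ => P₁ (γ θ)) := hP₁4.comp hγ
  have hΦP : ContDiff ℝ 4 (fun θ => Φ θ * P₁ (γ θ)) := hΦd.mul hPγ
  have hΔγ : ContDiff ℝ 4 (Δ ∘ γ) := hΔ4.comp hγ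
  have hRs : ContDiff ℝ 4 (fun θ : ℝ => I (γ θ)) := by rw [hR]; exact hΦP.add hΔγ
  refine ⟨hRs, fun k hk => ?_⟩
  have hk' : (k : WithTop ℕ∞) ≤ 4 := by exact_mod_cast hk
  -- Bell rows for `P₁ ∘ γ` and `Δ ∘ γ`
  have hPjet : ∀ m, 1 ≤ m → m ≤ 4 → ‖iteratedFDeriv ℝ m P₁ (γ θ)‖ ≤ Mm m := fun m _ hm => norm_iteratedFDeriv_nearPoly_le H m (γ θ) (hMm m hm)
  have hbellP := abs_iteratedDeriv_comp_le_bell (F := P₁) hP₁4 hγ (M := Mm) (D := Dc) hPjet hDc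
  have hbellΔ := abs_iteratedDeriv_comp_le_bell (F := Δ) hΔ4 hγ (M := AL) (D := Dc) (fun m _ hm => hΔjet m hm (γ θ)) hDc
  have hPP : ∀ l ≤ 4, |iteratedDeriv l (fun θ => P₁ (γ θ)) θ| ≤ PP l := by
    intro l hl
    have hcomp : (fun θ => P₁ (γ θ)) = P₁ ∘ γ := rfl
    rw [hcomp]
    rcases l with _ | _ | _ | _ | _ | l
    · rw [iteratedDeriv_zero, Function.comp_apply]
      have h0 := norm_iteratedFDeriv_nearPoly_le H 0 (γ θ) (hMm 0 (by norm_num))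
      rw [norm_iteratedFDeriv_zero, Real.norm_eq_abs] at h0
      exact h0.trans hPP0
    · exact hbellP.1.trans hPP1
    · exact hbellP.2.1.trans hPP2
    · exact hbellP.2.2.1.trans hPP3
    · exact hbellP.2.2.2.trans hPP4
    · omega
  have hAA : |iteratedDeriv k (Δ ∘ γ) θ| ≤ AA k := by
    rcases k with _ | _ | _ | _ | _ | k
    · rw [iteratedDeriv_zero, Function.comp_apply]
      have h0 := hΔjet 0 (by norm_num) (γ θ)
      rw [norm_iteratedFDeriv_zero, Real.norm_eq_abs] at h0
      exact h0.trans hAA0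
    · exact hbellΔ.1.trans hAA1
    · exact hbellΔ.2.1.trans hAA2
    · exact hbellΔ.2.2.1.trans hAA3
    · exact hbellΔ.2.2.2.trans hAA4
    · omega
  -- Leibniz for `Φ · (P₁ ∘ γ)`
  have hLeib : |iteratedDeriv k (fun θ => Φ θ * P₁ (γ θ)) θ| ≤ ∑ i ∈ range (k + 1), (k.choose i : ℝ) * φ i * PP (k - i) := by
    have h1 := norm_iteratedDeriv_mul_le (𝔸 := ℝ) (hΦd.of_le hk') (hPγ.of_le hk') θ
    rw [Real.norm_eq_abs] at h1
    refine h1.trans (sum_le_sum fun i hi => ?_)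
    have hik : i ≤ k := Nat.lt_succ_iff.1 (mem_range.1 hi)
    rw [Real.norm_eq_abs, Real.norm_eq_abs, mul_assoc, mul_assoc]
    refine mul_le_mul_of_nonneg_left ?_ (Nat.cast_nonneg _)
    exact mul_le_mul (hφ i (hik.trans hk)) (hPP (k - i) ((Nat.sub_le k i).trans hk)) (abs_nonneg _) ((abs_nonneg _).trans (hφ i (hik.trans hk)))
  -- assemble
  show |iteratedDeriv k (fun θ : ℝ => I (γ θ)) θ| ≤ _
  rw [hR, iteratedDeriv_add (hΦP.contDiffAt.of_le hk') (hΔγ.contDiffAt.of_le hk')]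
  exact (abs_add_le _ _).trans (add_le_add hLeib hAA)

end Summit.HubbardSuperconductivity.HubbardSuperconductivity.Theorems.EngineV8

end
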